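import Mathlib.Combinatorics.SimpleGraph.Paths
import Literature.Probability.RandomPlanarGeometry.SAWFiniteMemory
import Literature.Computation.FiniteGraph.PolyCert
import HarnessLib

/-!
# Finite-graph witness engine, VI: self-avoiding-walk length polynomials on `ℤ²` induced on a
# finite site set (enumeration, soundness, completeness, counting recursion)

Topic `Literature/Computation/FiniteGraph`; everything proved, no facts. The planar SAW statements
of the tree (`Literature.Probability.RandomPlanarGeometry.SAW.weight Ω δ a b`, routes
`SAWTotalPositivity`, `SAWLeftRightFKG`) concern, for lattice domains, the graph `ℤ²` induced on a
finite set of sites (`LatticeDobrushin.adj_iff`: `Adj x y ↔ (zdGraph 2).Adj x y ∧ x ∈ S ∧ y ∈ S`).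
For such a graph `G` on `Site 2 = Fin 2 → ℤ`, described by a site list `S : List (ℤ × ℤ)` through
`hG : ∀ x y, G.Adj x y ↔ (zdGraph 2).Adj x y ∧ toPair x ∈ S ∧ toPair y ∈ S`, this file provides

* `ofPair` (inverse of the tree's `SAW.FiniteMemory.toPair : Site 2 → ℤ × ℤ`, which is reused, not
  redefined) and `nbrs` with `zdGraph_adj_iff_mem_nbrs` (the four lattice neighbours);
* the depth-first enumeration `sawSupports S b k u vis` of the supports (as lists of integer
  pairs) of the self-avoiding paths `u → b` of `G` avoiding `vis`, with fuel `k`, and its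
  COMPLETENESS (`map_support_mem_sawSupports`), SOUNDNESS (`exists_walk_of_mem_sawSupports`) and
  duplicate-freeness (`nodup_sawSupports`);
* the same recursion counting by length, `sawHist`, and `sawCounts S a b : List ℕ` (entry `ℓ` =
  number of `ℓ`-step SAWs `a → b` in `ℤ²[S]`), with the evaluation identity
  `peval_sawHist : peval (ofNatList (sawHist …)) x = Σ_{s ∈ sawSupports …} x^{|s| − 1}` — the kernel
  evaluates only the counts, never the (large) list of supports;
* the fuel bound `length_le_of_isPath` (a SAW of `G` has at most `|S|` vertices).

The identification `SAW.weight Ω δ a b univ = ofReal (peval (ofNatList (sawCounts S a b)) x_c)`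
and the product-inequality certificates are the companion file `SAWWeightBridge.lean`.
Kernel example: on the `3 × 3` box, corner to centre, `sawCounts = [0, 0, 2, 0, 2, 0, 2, 0, 2]`.
[folklore] throughout (Madras–Slade 1993, §1.1 for SAWs; the enumeration is the textbook DFS).

## References
* N. Madras, G. Slade, *The Self-Avoiding Walk*, Birkhäuser 1993, §1.1 [MadrasSlade1993].
-/

namespace Literature.Computation.FiniteGraph

open Literature.Probability.LatticeModels
open Literature.Probability.RandomPlanarGeometry.SAW.FiniteMemory (toPair toPair_injective)

/-! ### Sites of `ℤ²` as integer pairs; the four neighbours -/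

/-- An integer pair as a site of `ℤ²` (inverse of the tree's `SAW.FiniteMemory.toPair x = (x 0, x 1)`).
[folklore] -/
def ofPair (p : ℤ × ℤ) : Site 2 := ![p.1, p.2]

/-- [folklore] -/
@[simp] theorem toPair_ofPair (p : ℤ × ℤ) : toPair (ofPair p) = p := by
  simp [toPair, ofPair]

/-- [folklore] -/
@[simp] theorem ofPair_toPair (x : Site 2) : ofPair (toPair x) = x := by
  funext i; fin_cases i <;> simp [toPair, ofPair]

/-- The four lattice neighbours of an integer pair, in the order E, W, N, S. [folklore] -/
def nbrs (p : ℤ × ℤ) : List (ℤ × ℤ) := [(p.1 + 1, p.2), (p.1 - 1, p.2), (p.1, p.2 + 1), (p.1, p.2 - 1)]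

/-- A pair is not its own neighbour. [folklore] -/
theorem not_mem_nbrs_self (p : ℤ × ℤ) : p ∉ nbrs p := by
  obtain ⟨a, b⟩ := p
  simp [nbrs]
  omega

/-- The four neighbours are distinct. [folklore] -/
theorem nodup_nbrs (p : ℤ × ℤ) : (nbrs p).Nodup := by
  obtain ⟨a, b⟩ := p
  simp [nbrs]
  omega

/-- **Lattice adjacency in pair form**: `x ∼ y` in `ℤ²` iff `toPair y` is one of the four neighbours
of `toPair x`. [folklore] -/
theorem zdGraph_adj_iff_mem_nbrs (x y : Site 2) : (zdGraph 2).Adj x y ↔ toPair y ∈ nbrs (toPair x) := by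
  rw [zdGraph_adj_iff]
  simp only [nbrs, toPair, List.mem_cons, Prod.mk.injEq, List.not_mem_nil, or_false]
  constructor
  · rintro ⟨i, h | h⟩
    · fin_cases i
      · left; rw [h]; simp
      · right; right; left; rw [h]; simp
    · fin_cases i
      · right; left; rw [h]; simp
      · right; right; right; rw [h]; simp
  · have hy : y = ![y 0, y 1] := funext (Fin.forall_fin_two.2 ⟨rfl, rfl⟩)
    have hx : x = ![x 0, x 1] := funext (Fin.forall_fin_two.2 ⟨rfl, rfl⟩)
    rintro (⟨h0, h1⟩ | ⟨h0, h1⟩ | ⟨h0, h1⟩ | ⟨h0, h1⟩)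
    · refine ⟨0, Or.inl ?_⟩
      rw [hy, hx]; funext j; fin_cases j <;> simp [h0, h1]
    · refine ⟨0, Or.inr ?_⟩
      rw [hy, hx]; funext j; fin_cases j <;> simp [h0, h1]
    · refine ⟨1, Or.inl ?_⟩
      rw [hy, hx]; funext j; fin_cases j <;> simp [h0, h1]
    · refine ⟨1, Or.inr ?_⟩
      rw [hy, hx]; funext j; fin_cases j <;> simp [h0, h1]

/-! ### The enumeration and the counting recursion -/

/-- The admissible next sites from `u`: lattice neighbours in `S`, `u` itself in `S`, not yet
visited. [folklore] -/
def nextSites (S : List (ℤ × ℤ)) (u : ℤ × ℤ) (vis : List (ℤ × ℤ)) : List (ℤ × ℤ) :=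
  (nbrs u).filter fun w => decide (u ∈ S) && decide (w ∈ S) && !decide (w ∈ vis)

/-- Membership in `nextSites`. [folklore] -/
theorem mem_nextSites_iff {S : List (ℤ × ℤ)} {u w : ℤ × ℤ} {vis : List (ℤ × ℤ)} :
    w ∈ nextSites S u vis ↔ w ∈ nbrs u ∧ u ∈ S ∧ w ∈ S ∧ w ∉ vis := by
  simp [nextSites, List.mem_filter, and_assoc]

/-- **The enumeration**: the supports (lists of pairs) of all self-avoiding paths from `u` to `b` in
`ℤ²[S]` whose vertices after `u` avoid `vis`, found by depth-first search with fuel `k` (a bound on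
the number of steps). [folklore] -/
def sawSupports (S : List (ℤ × ℤ)) (b : ℤ × ℤ) : ℕ → ℤ × ℤ → List (ℤ × ℤ) → List (List (ℤ × ℤ))
  | 0, u, _ => if u = b then [[u]] else []
  | k + 1, u, vis => if u = b then [[u]] else
      (nextSites S u vis).flatMap fun w => (sawSupports S b k w (u :: vis)).map (List.cons u)

/-- Pointwise sum of two count lists. [folklore] -/
def histAdd : List ℕ → List ℕ → List ℕ
  | [], q => q
  | c :: p, [] => c :: p
  | c :: p, d :: q => (c + d) :: histAdd p q

/-- Sum of a list of count lists. [folklore] -/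
def histSum : List (List ℕ) → List ℕ
  | [] => []
  | h :: l => histAdd h (histSum l)

/-- **The counting recursion**: the same search, returning only the number of paths of each length
(entry `ℓ` = paths with `ℓ` steps). [folklore] -/
def sawHist (S : List (ℤ × ℤ)) (b : ℤ × ℤ) : ℕ → ℤ × ℤ → List (ℤ × ℤ) → List ℕ
  | 0, u, _ => if u = b then [1] else []
  | k + 1, u, vis => if u = b then [1] else
      histSum ((nextSites S u vis).map fun w => 0 :: sawHist S b k w (u :: vis))

/-- **`sawCounts S a b`**: entry `ℓ` is the number of `ℓ`-step self-avoiding walks from `a` to `b`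
in `ℤ²` induced on the sites `S` (fuel `|S|`, enough by `length_le_of_isPath`). [folklore] -/
def sawCounts (S : List (ℤ × ℤ)) (a b : ℤ × ℤ) : List ℕ :=
  sawHist S b S.length a []

/-- [folklore] -/
theorem peval_ofNatList_histAdd : ∀ (p q : List ℕ) (x : ℝ),
    peval (ofNatList (histAdd p q)) x = peval (ofNatList p) x + peval (ofNatList q) x
  | [], q, x => by simp [histAdd]
  | c :: p, [], x => by simp [histAdd]
  | c :: p, d :: q, x => by
      rw [histAdd, peval_ofNatList_cons, peval_ofNatList_histAdd p q x, peval_ofNatList_cons,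
        peval_ofNatList_cons, Nat.cast_add]
      ring

/-- [folklore] -/
theorem peval_ofNatList_histSum (x : ℝ) : ∀ (l : List (List ℕ)),
    peval (ofNatList (histSum l)) x = (l.map fun h => peval (ofNatList h) x).sum
  | [] => by simp [histSum]
  | h :: l => by rw [histSum, peval_ofNatList_histAdd, peval_ofNatList_histSum x l, List.map_cons, List.sum_cons]

/-- Every enumerated support starts with the start vertex. [folklore] -/
theorem exists_eq_cons_of_mem_sawSupports (S : List (ℤ × ℤ)) (b : ℤ × ℤ) :
    ∀ (k : ℕ) (u : ℤ × ℤ) (vis : List (ℤ × ℤ)) {s : List (ℤ × ℤ)}, s ∈ sawSupports S b k u vis → ∃ t, s = u :: t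
  | 0, u, vis, s, hs => by
      unfold sawSupports at hs
      split_ifs at hs <;> simp_all
  | k + 1, u, vis, s, hs => by
      unfold sawSupports at hs
      split_ifs at hs
      · simp_all
      · simp only [List.mem_flatMap, List.mem_map] at hs
        obtain ⟨w, -, t, -, rfl⟩ := hs
        exact ⟨_, rfl⟩

/-- **The counting recursion evaluates the length generating function of the enumeration**:
`peval (ofNatList (sawHist S b k u vis)) x = Σ_{s ∈ sawSupports S b k u vis} x^{|s| − 1}`. [folklore] -/
theorem peval_sawHist (S : List (ℤ × ℤ)) (b : ℤ × ℤ) (x : ℝ) :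
    ∀ (k : ℕ) (u : ℤ × ℤ) (vis : List (ℤ × ℤ)), peval (ofNatList (sawHist S b k u vis)) x =
      ((sawSupports S b k u vis).map fun s => x ^ (s.length - 1)).sum
  | 0, u, vis => by
      unfold sawHist sawSupports
      split_ifs <;> simp [ofNatList]
  | k + 1, u, vis => by
      unfold sawHist sawSupports
      split_ifs with hub
      · simp [ofNatList]
      · rw [peval_ofNatList_histSum, List.map_map]
        -- both sides are sums over the admissible next sites
        induction nextSites S u vis with
        | nil => simp
        | cons w ws ih =>
            rw [List.map_cons, List.sum_cons, ih, List.flatMap_cons, List.map_append, List.sum_append]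
            congr 1
            rw [Function.comp_apply, peval_ofNatList_cons, Nat.cast_zero, zero_add, peval_sawHist S b x k w (u :: vis),
              List.map_map, ← List.sum_map_mul_left]
            refine congrArg List.sum (List.map_congr_left fun s hs => ?_)
            obtain ⟨t, rfl⟩ := exists_eq_cons_of_mem_sawSupports S b k w (u :: vis) hs
            simp [pow_succ']

/-! ### Completeness, soundness and duplicate-freeness of the enumeration -/

/-- A self-avoiding path that has come back to its start is trivial. [folklore] -/
theorem eq_of_isPath_of_eq {G : SimpleGraph (Site 2)} {u b : Site 2} (p : G.Walk u b) (hp : p.IsPath)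
    (hub : u = b) : p.length = 0 := by
  subst hub
  cases p with
  | nil => rfl
  | cons h q =>
      rw [SimpleGraph.Walk.cons_isPath_iff] at hp
      exact absurd q.end_mem_support hp.2

section Graph

variable {S : List (ℤ × ℤ)} {G : SimpleGraph (Site 2)}
  (hG : ∀ x y : Site 2, G.Adj x y ↔ (zdGraph 2).Adj x y ∧ toPair x ∈ S ∧ toPair y ∈ S)
include hG

/-- **Completeness**: the support of every self-avoiding path `u → b` of `G` with at most `k` steps
whose vertices avoid `vis` is enumerated. [folklore] -/
theorem map_support_mem_sawSupports (b : Site 2) :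
    ∀ (k : ℕ) {u : Site 2} (p : G.Walk u b) (vis : List (ℤ × ℤ)), p.IsPath → p.length ≤ k →
      (∀ x ∈ p.support, toPair x ∉ vis) →
      p.support.map toPair ∈ sawSupports S (toPair b) k (toPair u) vis := by
  intro k
  induction k with
  | zero =>
      intro u p vis hp hlen _
      have h0 : p.length = 0 := Nat.le_zero.1 hlen
      cases p with
      | nil => simp [sawSupports]
      | cons h q => simp at h0
  | succ k ih =>
      intro u p vis hp hlen hvis
      cases p with
      | nil => simp [sawSupports]
      | @cons _ w _ h q =>
          rw [SimpleGraph.Walk.cons_isPath_iff] at hp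
          obtain ⟨hq, hu⟩ := hp
          have hub : toPair u ≠ toPair b := fun heq => by
            have := eq_of_isPath_of_eq (SimpleGraph.Walk.cons h q)
              ((SimpleGraph.Walk.cons_isPath_iff h q).2 ⟨hq, hu⟩) (toPair_injective heq)
            simp at this
          rw [sawSupports, if_neg hub, SimpleGraph.Walk.support_cons, List.map_cons, List.mem_flatMap]
          obtain ⟨hadj, huS, hwS⟩ := (hG u w).1 h
          have hw : w ∈ q.support := q.start_mem_support
          refine ⟨toPair w, mem_nextSites_iff.2 ⟨(zdGraph_adj_iff_mem_nbrs u w).1 hadj, huS, hwS,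
            hvis w (by simp [hw])⟩, ?_⟩
          rw [List.mem_map]
          refine ⟨q.support.map toPair, ih q (toPair u :: vis) hq (by simp at hlen; omega) ?_, rfl⟩
          intro x hx
          simp only [List.mem_cons, not_or]
          exact ⟨fun heq => hu (toPair_injective heq ▸ hx), hvis x (by simp [hx])⟩

/-- **Soundness**: every enumerated list is the support of a self-avoiding path `u → b` of `G` whose
vertices other than `u` avoid `vis`. [folklore] -/
theorem exists_walk_of_mem_sawSupports (b : Site 2) :
    ∀ (k : ℕ) (u : Site 2) (vis s : List (ℤ × ℤ)), s ∈ sawSupports S (toPair b) k (toPair u) vis →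
      ∃ p : G.Walk u b, p.IsPath ∧ p.support.map toPair = s ∧ ∀ x ∈ p.support, x = u ∨ toPair x ∉ vis := by
  intro k
  induction k with
  | zero =>
      intro u vis s hs
      unfold sawSupports at hs
      split_ifs at hs with hub
      · have hub' : u = b := toPair_injective hub
        subst hub'
        simp only [List.mem_singleton] at hs
        subst hs
        exact ⟨SimpleGraph.Walk.nil, SimpleGraph.Walk.IsPath.nil, by simp, by simp⟩
      · simp at hs
  | succ k ih =>
      intro u vis s hs
      unfold sawSupports at hs
      split_ifs at hs with hub
      · have hub' : u = b := toPair_injective hub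
        subst hub'
        simp only [List.mem_singleton] at hs
        subst hs
        exact ⟨SimpleGraph.Walk.nil, SimpleGraph.Walk.IsPath.nil, by simp, by simp⟩
      · simp only [List.mem_flatMap, List.mem_map] at hs
        obtain ⟨w', hw', s', hs', rfl⟩ := hs
        obtain ⟨hnb, huS, hwS, hwvis⟩ := mem_nextSites_iff.1 hw'
        obtain ⟨q, hq, hsupp, hinv⟩ := ih (ofPair w') (toPair u :: vis) s' (by rwa [toPair_ofPair])
        have hadj : G.Adj u (ofPair w') := by
          rw [hG, zdGraph_adj_iff_mem_nbrs, toPair_ofPair]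
          exact ⟨hnb, huS, hwS⟩
        have hu : u ∉ q.support := fun hmem => by
          rcases hinv u hmem with h | h
          · exact not_mem_nbrs_self (toPair u) (by rw [h, toPair_ofPair] at hnb ⊢; exact hnb)
          · exact h List.mem_cons_self
        refine ⟨SimpleGraph.Walk.cons hadj q, (SimpleGraph.Walk.cons_isPath_iff _ _).2 ⟨hq, hu⟩,
          by rw [SimpleGraph.Walk.support_cons, List.map_cons, hsupp], ?_⟩
        intro x hx
        rw [SimpleGraph.Walk.support_cons, List.mem_cons] at hx
        rcases hx with rfl | hx
        · exact Or.inl rfl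
        · right
          rcases hinv x hx with rfl | h
          · rw [toPair_ofPair]; exact hwvis
          · exact fun h' => h (List.mem_cons_of_mem _ h')

end Graph

/-- **No support is enumerated twice.** [folklore] -/
theorem nodup_sawSupports (S : List (ℤ × ℤ)) (b : ℤ × ℤ) :
    ∀ (k : ℕ) (u : ℤ × ℤ) (vis : List (ℤ × ℤ)), (sawSupports S b k u vis).Nodup
  | 0, u, vis => by
      unfold sawSupports; split_ifs <;> simp
  | k + 1, u, vis => by
      unfold sawSupports
      split_ifs
      · simp
      · rw [List.nodup_flatMap]
        refine ⟨fun w _ => (nodup_sawSupports S b k w (u :: vis)).map (List.cons_injective), ?_⟩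
        refine List.Nodup.pairwise_of_forall_ne ((nodup_nbrs u).filter _) fun w _ w' _ hne => ?_
        simp only [Function.onFun, List.disjoint_left, List.mem_map]
        rintro _ ⟨s, hs, rfl⟩ ⟨s', hs', heq⟩
        obtain ⟨t, rfl⟩ := exists_eq_cons_of_mem_sawSupports S b k w (u :: vis) hs
        obtain ⟨t', rfl⟩ := exists_eq_cons_of_mem_sawSupports S b k w' (u :: vis) hs'
        simp only [List.cons.injEq, true_and] at heq
        exact hne heq.1.symm

/-! ### The fuel bound -/

/-- A self-avoiding path of `G` from a site of `S` has at most `|S|` vertices, hence fewer than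
`|S|` steps; in particular `p.length ≤ S.length` always (a path from a site outside `S` is trivial).
[folklore] -/
theorem length_le_of_isPath {S : List (ℤ × ℤ)} {G : SimpleGraph (Site 2)}
    (hG : ∀ x y : Site 2, G.Adj x y ↔ (zdGraph 2).Adj x y ∧ toPair x ∈ S ∧ toPair y ∈ S)
    {u v : Site 2} (p : G.Walk u v) (hp : p.IsPath) : p.length ≤ S.length := by
  classical
  cases p with
  | nil => exact Nat.zero_le _
  | @cons _ w _ h q =>
      -- every vertex of a nontrivial walk lies in `S`
      have hsub : ∀ x ∈ (SimpleGraph.Walk.cons h q).support, toPair x ∈ S := by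
        intro x hx
        rw [SimpleGraph.Walk.support_cons, List.mem_cons] at hx
        rcases hx with rfl | hx
        · exact ((hG _ _).1 h).2.1
        · -- induction along `q`: each support vertex is an endpoint of an edge of `G`
          have key : ∀ {a c : Site 2} (r : G.Walk a c), toPair a ∈ S → ∀ y ∈ r.support, toPair y ∈ S := by
            intro a c r ha
            induction r with
            | nil => intro y hy; simp at hy; rw [hy]; exact ha
            | cons h' r' ih' =>
                intro y hy
                rw [SimpleGraph.Walk.support_cons, List.mem_cons] at hy
                rcases hy with rfl | hy
                · exact ha
                · exact ih' ((hG _ _).1 h').2.2 y hy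
          exact key q ((hG _ _).1 h).2.2 x hx
      have hnd : ((SimpleGraph.Walk.cons h q).support.map toPair).Nodup :=
        hp.support_nodup.map toPair_injective
      have hsubset : ((SimpleGraph.Walk.cons h q).support.map toPair).toFinset ⊆ S.toFinset := by
        intro z hz
        rw [List.mem_toFinset, List.mem_map] at hz
        obtain ⟨x, hx, rfl⟩ := hz
        exact List.mem_toFinset.2 (hsub x hx)
      have h1 := List.toFinset_card_of_nodup hnd
      have h2 := Finset.card_le_card hsubset
      have h3 := List.toFinset_card_le S
      rw [List.length_map, SimpleGraph.Walk.length_support] at h1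
      omega

/-! ### Kernel regression example -/

/-- The `3 × 3` box `{0,1,2}²`, corner `(0,0)` to centre `(1,1)`: two SAWs of each even length
`2, 4, 6, 8` (cf. the hand count `Z = 2x² + 2x⁴ + 2x⁶ + 2x⁸`). -/
example : sawCounts [(0, 0), (0, 1), (0, 2), (1, 0), (1, 1), (1, 2), (2, 0), (2, 1), (2, 2)] (0, 0) (1, 1) =
    [0, 0, 2, 0, 2, 0, 2, 0, 2] := by
  decide +kernel

end Literature.Computation.FiniteGraph
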